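import Summits.RiemannHypothesis.RiemannHypothesis.Theorems.JensenPolynomialsPhiCellArith
import Literature.NumberTheory.LFunctions.DeBruijnPhiSecondDeriv

/-!
# Route `JensenPolynomials`, item `XiDeltaSqPos` (S-T5) — toolbox 3: cell enclosures of the theta series
`e^{y₀}∑_n P(y_n)e^{−y_n}` (RH-FREE; cell rh-jensen, HUMAN RULING D-0040)

Third piece of the kernel certificate that discharges the route's crux `XiDeltaSqPos` zero-free (Csordas–Varga 1988,
Theorem 2.2: `log Φ(√t)` strictly concave; the Turán inequalities of `ξ`'s Taylor data, Csordas–Norfolk–Varga 1986).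
For a rational coefficient list `P` (low degree first) and `x > 0` put `y_n = π(n+1)²x` (the tree's `thetaFreq x n`)
and `F_P(x) = ∑_n P(y_n)e^{−y_n}` (`qterm`, `summable_qterm`); every derivative of the Pólya–de Bruijn kernel is
`Φ^{(m)}(u) = eᵘ F_{P_m}(e^{4u})` (tree: `deBruijnPhi_eq_tsum`, `deBruijnPhiDeriv_eq_tsum`, `deBruijnPhiDeriv₂_eq_tsum`,
`deBruijnPhiDeriv₃_eq_tsum`, `deBruijnPhiDeriv₄_eq_tsum`). We PROVE:

* the TAIL BOUND `|∑_{n≥2} P(y_n)e^{−y_n}| ≤ (1 + 2·10⁻⁶)·|P|(9y₀)·e^{−9y₀}` for `y₀ ≥ 3` and degree `≤ 6`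
  (`abs_tsum_qterm_tail_le`; each monomial: `y_{n+2}^k e^{−y_{n+2}} ≤ (9y₀)^k e^{−9y₀}·e^{−14n}` from `r ≤ e^{r−1}`);
* the COMPUTABLE cell enclosure `cellIv P a h ∋ e^{y₀}F_P(x)` for all `y₀ ∈ [a, a + h]`, `a ≥ 3` (`mem_cellIv`):
  `e^{y₀}F_P = P(y₀) + P(4y₀)e^{−3y₀} + e^{y₀}·tail`, with exact Taylor ranges of `P(y)` and `P(4y)` over the cell,
  `e^{−3y₀} ∈ [e^{−3(a+h)}, e^{−3a}]` and the tail widened by `(1 + 2·10⁻⁶)|P|(9(a+h))e^{−8a}` (toolbox 2's certified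
  exponentials and interval arithmetic).

WHAT THIS IS NOT: nothing here bears on the zeros of `ζ`. References: Csordas–Varga, Constr. Approx. 4 (1988), Thm 2.2
[CsordasVarga1988]; Varga, *Scientific Computation on Mathematical Problems and Conjectures* (1990) §3.3 [Varga1990].
-/

-- D-0017: `Summit.RiemannHypothesis.RiemannHypothesis.…` duplicates the namespace BY DESIGN (single-problem summit).
set_option linter.dupNamespace false

namespace Summit.RiemannHypothesis.RiemannHypothesis.Theorems.JensenPolynomials.CoeffTable

open Finset Literature.NumberTheory.LFunctions
open scoped BigOperators Nat Real

/-! ## 5. The theta series `∑_n P(y_n)e^{−y_n}` for a coefficient list `P` -/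

/-- The `n`-th term `P(y_n)e^{−y_n}`, `y_n = π(n+1)²x`, for a rational coefficient list `P`. -/
noncomputable def qterm (cs : List ℚ) (x : ℝ) (n : ℕ) : ℝ :=
  pevalR cs (thetaFreq x n) * Real.exp (-thetaFreq x n)

/-- Termwise absolute values of a coefficient list. -/
def absList (cs : List ℚ) : List ℚ := cs.map fun c => |c|

/-- Coefficients of `P(4y)` as a polynomial in `y`. -/
def scale4 : List ℚ → List ℚ
  | [] => []
  | c :: cs => c :: (scale4 cs).map fun d => 4 * d

/-- `pevalR` of a `4`-scaled list. -/
theorem pevalR_map_four (cs : List ℚ) (y : ℝ) : pevalR (cs.map fun d => 4 * d) y = 4 * pevalR cs y := by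
  induction cs with
  | nil => simp [pevalR]
  | cons c cs ih => simp only [List.map, pevalR, ih]; push_cast; ring

/-- `scale4 P` evaluates to `P(4y)`. -/
theorem pevalR_scale4 (cs : List ℚ) (y : ℝ) : pevalR (scale4 cs) y = pevalR cs (4 * y) := by
  induction cs with
  | nil => simp [scale4, pevalR]
  | cons c cs ih => simp only [scale4, pevalR, pevalR_map_four, ih]; ring

/-- `|P(Y)| ≤ |P|(Y)` for `Y ≥ 0` (coefficients replaced by absolute values). -/
theorem abs_pevalR_le (cs : List ℚ) {Y : ℝ} (hY : 0 ≤ Y) : |pevalR cs Y| ≤ pevalR (absList cs) Y := by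
  induction cs with
  | nil => simp [pevalR, absList]
  | cons c cs ih =>
    simp only [pevalR, absList, List.map] at ih ⊢
    calc |(c : ℝ) + Y * pevalR cs Y| ≤ |(c : ℝ)| + |Y * pevalR cs Y| := abs_add_le _ _
      _ = |(c : ℝ)| + Y * |pevalR cs Y| := by rw [abs_mul, abs_of_nonneg hY]
      _ ≤ ((|c| : ℚ) : ℝ) + Y * pevalR (List.map (fun c => |c|) cs) Y := by
          push_cast; exact add_le_add le_rfl (mul_le_mul_of_nonneg_left ih hY)

/-- `|P|` has nonnegative values at `Y ≥ 0`. -/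
theorem pevalR_absList_nonneg (cs : List ℚ) {Y : ℝ} (hY : 0 ≤ Y) : 0 ≤ pevalR (absList cs) Y :=
  le_trans (abs_nonneg _) (abs_pevalR_le cs hY)

/-- `|P|` is monotone on `[0, ∞)`. -/
theorem pevalR_absList_mono (cs : List ℚ) {Y Z : ℝ} (hY : 0 ≤ Y) (hYZ : Y ≤ Z) :
    pevalR (absList cs) Y ≤ pevalR (absList cs) Z := by
  induction cs with
  | nil => simp [pevalR, absList]
  | cons c cs ih =>
    simp only [pevalR, absList, List.map] at ih ⊢
    have h0 : 0 ≤ pevalR (List.map (fun c => |c|) cs) Z := pevalR_absList_nonneg cs (hY.trans hYZ)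
    exact add_le_add le_rfl (mul_le_mul hYZ ih (pevalR_absList_nonneg cs hY) (hY.trans hYZ))

/-- `y_n = (n+1)²·y_0`. -/
theorem thetaFreq_eq_mul_zero (x : ℝ) (n : ℕ) : thetaFreq x n = ((n : ℝ) + 1) ^ 2 * thetaFreq x 0 := by
  simp only [thetaFreq, Nat.cast_zero, zero_add, one_pow, mul_one]; ring

/-- `y_n ≥ 0` for `x ≥ 0`. -/
theorem thetaFreq_nonneg {x : ℝ} (hx : 0 ≤ x) (n : ℕ) : 0 ≤ thetaFreq x n := by
  unfold thetaFreq; positivity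

/-- Summability of `n ↦ y_n^k · P(y_n) · e^{−y_n}` for `x > 0`. -/
theorem summable_pow_mul_qterm (cs : List ℚ) {x : ℝ} (hx : 0 < x) (k : ℕ) :
    Summable fun n => thetaFreq x n ^ k * (pevalR cs (thetaFreq x n) * Real.exp (-thetaFreq x n)) := by
  induction cs generalizing k with
  | nil => simp only [pevalR, zero_mul, mul_zero]; exact summable_zero
  | cons c cs ih =>
    have h1 : Summable fun n => (c : ℝ) * (x ^ k * thetaMomentTerm k x n) :=
      ((summable_thetaMomentTerm k hx).mul_left _).mul_left _
    refine (h1.add (ih (k + 1))).congr fun n => ?_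
    rw [pow_mul_thetaMomentTerm]
    simp only [pevalR]; ring

/-- Summability of the series `∑_n P(y_n)e^{−y_n}`. -/
theorem summable_qterm (cs : List ℚ) {x : ℝ} (hx : 0 < x) : Summable (qterm cs x) :=
  (summable_pow_mul_qterm cs hx 0).congr fun n => by simp [qterm]

/-! ## 6. The tail `n ≥ 2`: `∑_{n≥2} |P|(y_n) e^{−y_n} ≤ (1 + 2·10⁻⁶)·|P|(9y_0)·e^{−9y_0}` (degree ≤ 6, `y_0 ≥ 3`) -/

/-- The tail constant `1 + 2·10⁻⁶ ≥ 1/(1 − e^{−14})`. -/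
def tailC : ℚ := 500001 / 500000

/-- `e^{−14} ≤ 10⁻⁶`. -/
theorem exp_neg_fourteen_le : Real.exp (-14) ≤ 1 / 1000000 := by
  have h1 : Real.exp 1 > 2.7 := lt_trans (by norm_num) Real.exp_one_gt_d9
  have h14 : Real.exp 14 = Real.exp 1 ^ 14 := by rw [← Real.exp_nat_mul]; norm_num
  have h2 : (1000000 : ℝ) ≤ Real.exp 14 := by
    rw [h14]; exact le_trans (by norm_num) (pow_le_pow_left₀ (by norm_num) h1.le 14)
  rw [Real.exp_neg, inv_eq_one_div]
  exact one_div_le_one_div_of_le (by norm_num) h2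

/-- One monomial of the tail: for `y_0 ≥ 3`, `k ≤ 6`:
`y_{n+2}^k e^{−y_{n+2}} ≤ (9y_0)^k e^{−9y_0} · (e^{−14})^n`. -/
theorem tail_term_le {x : ℝ} (hy : 3 ≤ thetaFreq x 0) {k : ℕ} (hk : k ≤ 6) (n : ℕ) :
    thetaFreq x (n + 2) ^ k * Real.exp (-thetaFreq x (n + 2)) ≤
      (9 * thetaFreq x 0) ^ k * Real.exp (-(9 * thetaFreq x 0)) * Real.exp (-14) ^ n := by
  set y := thetaFreq x 0 with hy0
  have hypos : 0 < y := by linarith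
  -- `y_{n+2} = r · 9y` with `r = (n+3)²/9 ≥ 1`, `r − 1 ≥ 2n/3`
  set r : ℝ := ((n : ℝ) + 3) ^ 2 / 9 with hr
  have hr1 : 1 ≤ r := by
    rw [hr, le_div_iff₀ (by norm_num)]; nlinarith [(n.cast_nonneg : (0 : ℝ) ≤ n)]
  have hrn : 2 * (n : ℝ) / 3 ≤ r - 1 := by
    rw [hr]; nlinarith [(n.cast_nonneg : (0 : ℝ) ≤ n)]
  have hYeq : thetaFreq x (n + 2) = r * (9 * y) := by
    rw [thetaFreq_eq_mul_zero x (n + 2), hr]; push_cast; ring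
  have h9y : 0 < 9 * y := by linarith
  -- `r^k ≤ e^{6(r−1)}`
  have hrexp : r ≤ Real.exp (r - 1) := by linarith [Real.add_one_le_exp (r - 1)]
  have hr0 : 0 ≤ r := le_trans zero_le_one hr1
  have hrk : r ^ k ≤ Real.exp (6 * (r - 1)) := by
    calc r ^ k ≤ r ^ 6 := pow_le_pow_right₀ hr1 hk
      _ ≤ Real.exp (r - 1) ^ 6 := pow_le_pow_left₀ hr0 hrexp 6
      _ = Real.exp (6 * (r - 1)) := by rw [← Real.exp_nat_mul]; norm_num
  -- assemble
  rw [hYeq, mul_pow]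
  have hexp : Real.exp (-(r * (9 * y))) = Real.exp (-(9 * y)) * Real.exp (-((r - 1) * (9 * y))) := by
    rw [← Real.exp_add]; congr 1; ring
  rw [hexp]
  have hdecay : Real.exp (6 * (r - 1)) * Real.exp (-((r - 1) * (9 * y))) ≤ Real.exp (-14) ^ n := by
    rw [← Real.exp_add, ← Real.exp_nat_mul]
    apply Real.exp_le_exp.2
    have h27 : 27 * (r - 1) ≤ (r - 1) * (9 * y) := by nlinarith
    nlinarith
  have hpos1 : 0 ≤ (9 * y) ^ k * Real.exp (-(9 * y)) := by positivity
  calc r ^ k * (9 * y) ^ k * (Real.exp (-(9 * y)) * Real.exp (-((r - 1) * (9 * y))))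
      = (9 * y) ^ k * Real.exp (-(9 * y)) * (r ^ k * Real.exp (-((r - 1) * (9 * y)))) := by ring
    _ ≤ (9 * y) ^ k * Real.exp (-(9 * y)) * (Real.exp (6 * (r - 1)) * Real.exp (-((r - 1) * (9 * y)))) := by
        gcongr
    _ ≤ (9 * y) ^ k * Real.exp (-(9 * y)) * Real.exp (-14) ^ n := by gcongr

/-- The monomial tail sum: `∑_n y_{n+2}^k e^{−y_{n+2}} ≤ tailC·(9y_0)^k e^{−9y_0}` (`k ≤ 6`, `y_0 ≥ 3`). -/
theorem tsum_tail_pow_le {x : ℝ} (hx : 0 < x) (hy : 3 ≤ thetaFreq x 0) {k : ℕ} (hk : k ≤ 6) :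
    ∑' n, thetaFreq x (n + 2) ^ k * Real.exp (-thetaFreq x (n + 2)) ≤
      (tailC : ℝ) * ((9 * thetaFreq x 0) ^ k * Real.exp (-(9 * thetaFreq x 0))) := by
  set A := (9 * thetaFreq x 0) ^ k * Real.exp (-(9 * thetaFreq x 0)) with hA
  have hA0 : 0 ≤ A := by positivity
  have hq0 : 0 ≤ Real.exp (-14) := (Real.exp_pos _).le
  have hq1 : Real.exp (-14) < 1 := by linarith [exp_neg_fourteen_le]
  have hgeom : Summable fun n : ℕ => A * Real.exp (-14) ^ n := (summable_geometric_of_lt_one hq0 hq1).mul_left A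
  have hle : ∀ n, thetaFreq x (n + 2) ^ k * Real.exp (-thetaFreq x (n + 2)) ≤ A * Real.exp (-14) ^ n :=
    fun n => tail_term_le hy hk n
  have hnn : ∀ n, 0 ≤ thetaFreq x (n + 2) ^ k * Real.exp (-thetaFreq x (n + 2)) := fun n => by
    have := thetaFreq_nonneg hx.le (n + 2); positivity
  have hsum : Summable fun n => thetaFreq x (n + 2) ^ k * Real.exp (-thetaFreq x (n + 2)) :=
    Summable.of_nonneg_of_le hnn hle hgeom
  calc ∑' n, thetaFreq x (n + 2) ^ k * Real.exp (-thetaFreq x (n + 2))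
      ≤ ∑' n : ℕ, A * Real.exp (-14) ^ n := hsum.tsum_le_tsum hle hgeom
    _ = A * (1 - Real.exp (-14))⁻¹ := by rw [tsum_mul_left, tsum_geometric_of_lt_one hq0 hq1]
    _ ≤ A * (tailC : ℝ) := by
        apply mul_le_mul_of_nonneg_left _ hA0
        rw [inv_le_comm₀ (by linarith) (by norm_num [tailC]), tailC]
        push_cast
        linarith [exp_neg_fourteen_le]
    _ = (tailC : ℝ) * A := mul_comm _ _

/-- The polynomial tail: for `|P|` (nonnegative coefficients `absList cs`), degree `k + |cs| ≤ 7`, `y_0 ≥ 3`: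
`∑_n y_{n+2}^k |P|(y_{n+2}) e^{−y_{n+2}} ≤ tailC · (9y_0)^k |P|(9y_0) e^{−9y_0}`. -/
theorem tsum_tail_poly_le (cs : List ℚ) {x : ℝ} (hx : 0 < x) (hy : 3 ≤ thetaFreq x 0) (k : ℕ)
    (hk : k + cs.length ≤ 7) :
    ∑' n, thetaFreq x (n + 2) ^ k * (pevalR (absList cs) (thetaFreq x (n + 2)) * Real.exp (-thetaFreq x (n + 2))) ≤
      (tailC : ℝ) * ((9 * thetaFreq x 0) ^ k * pevalR (absList cs) (9 * thetaFreq x 0) *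
        Real.exp (-(9 * thetaFreq x 0))) := by
  induction cs generalizing k with
  | nil => simp [pevalR, absList]
  | cons c cs ih =>
    simp only [List.length_cons] at hk
    have hk6 : k ≤ 6 := by omega
    have hsplit : ∀ n, thetaFreq x (n + 2) ^ k * (pevalR (absList (c :: cs)) (thetaFreq x (n + 2)) *
        Real.exp (-thetaFreq x (n + 2))) =
        ((|c| : ℚ) : ℝ) * (thetaFreq x (n + 2) ^ k * Real.exp (-thetaFreq x (n + 2))) +
        thetaFreq x (n + 2) ^ (k + 1) * (pevalR (absList cs) (thetaFreq x (n + 2)) *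
          Real.exp (-thetaFreq x (n + 2))) := fun n => by
      simp only [absList, List.map, pevalR]; ring
    have hs1 : Summable fun n => thetaFreq x (n + 2) ^ k * Real.exp (-thetaFreq x (n + 2)) := by
      have h := (summable_nat_add_iff 2).mpr (summable_pow_mul_qterm [1] hx k)
      refine h.congr fun n => ?_
      simp [pevalR]
    have hs2 : Summable fun n => thetaFreq x (n + 2) ^ (k + 1) * (pevalR (absList cs) (thetaFreq x (n + 2)) *
        Real.exp (-thetaFreq x (n + 2))) :=
      (summable_nat_add_iff 2).mpr (summable_pow_mul_qterm (absList cs) hx (k + 1))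
    rw [tsum_congr hsplit, (hs1.mul_left _).tsum_add hs2, tsum_mul_left]
    have hb1 := tsum_tail_pow_le hx hy hk6
    have hb2 := ih (k + 1) (by omega)
    have hc0 : (0 : ℝ) ≤ ((|c| : ℚ) : ℝ) := by exact_mod_cast abs_nonneg c
    have e : (tailC : ℝ) * ((9 * thetaFreq x 0) ^ k * pevalR (absList (c :: cs)) (9 * thetaFreq x 0) *
        Real.exp (-(9 * thetaFreq x 0))) =
        ((|c| : ℚ) : ℝ) * ((tailC : ℝ) * ((9 * thetaFreq x 0) ^ k * Real.exp (-(9 * thetaFreq x 0)))) +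
        (tailC : ℝ) * ((9 * thetaFreq x 0) ^ (k + 1) * pevalR (absList cs) (9 * thetaFreq x 0) *
          Real.exp (-(9 * thetaFreq x 0))) := by
      simp only [absList, List.map, pevalR]; ring
    rw [e]
    exact add_le_add (mul_le_mul_of_nonneg_left hb1 hc0) hb2

/-- **The tail bound**: `|∑_{n} P(y_{n+2})e^{−y_{n+2}}| ≤ tailC·|P|(9y_0)·e^{−9y_0}` for `|cs| ≤ 7`, `y_0 ≥ 3`. -/
theorem abs_tsum_qterm_tail_le (cs : List ℚ) (hlen : cs.length ≤ 7) {x : ℝ} (hx : 0 < x)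
    (hy : 3 ≤ thetaFreq x 0) :
    |∑' n, qterm cs x (n + 2)| ≤
      (tailC : ℝ) * (pevalR (absList cs) (9 * thetaFreq x 0) * Real.exp (-(9 * thetaFreq x 0))) := by
  have hmain := tsum_tail_poly_le cs hx hy 0 (by simpa using hlen)
  simp only [pow_zero, one_mul] at hmain
  have hs : Summable fun n => qterm cs x (n + 2) := (summable_nat_add_iff 2).mpr (summable_qterm cs hx)
  have hsabs : Summable fun n => pevalR (absList cs) (thetaFreq x (n + 2)) * Real.exp (-thetaFreq x (n + 2)) := by
    have h := (summable_nat_add_iff 2).mpr (summable_pow_mul_qterm (absList cs) hx 0)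
    simpa using h
  have hterm : ∀ n, |qterm cs x (n + 2)| ≤
      pevalR (absList cs) (thetaFreq x (n + 2)) * Real.exp (-thetaFreq x (n + 2)) := fun n => by
    unfold qterm
    rw [abs_mul, abs_of_pos (Real.exp_pos _)]
    exact mul_le_mul_of_nonneg_right (abs_pevalR_le cs (thetaFreq_nonneg hx.le _)) (Real.exp_pos _).le
  have h1 : ∑' n, qterm cs x (n + 2) ≤ ∑' n, pevalR (absList cs) (thetaFreq x (n + 2)) *
      Real.exp (-thetaFreq x (n + 2)) := hs.tsum_le_tsum (fun n => (abs_le.mp (hterm n)).2) hsabs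
  have h2 : ∑' n, -(pevalR (absList cs) (thetaFreq x (n + 2)) * Real.exp (-thetaFreq x (n + 2))) ≤
      ∑' n, qterm cs x (n + 2) := hsabs.neg.tsum_le_tsum (fun n => (abs_le.mp (hterm n)).1) hs
  rw [tsum_neg] at h2
  exact abs_le.mpr ⟨by linarith, by linarith⟩

/-! ## 7. The cell enclosure of `e^{y_0}·∑_n P(y_n)e^{−y_n}` -/

/-- **Cell enclosure** of `e^{y_0} ∑_n P(y_n)e^{−y_n} = P(y_0) + P(4y_0)e^{−3y_0} + e^{y_0}·(tail)` for `y_0 ∈ [a, a+h]`: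
Taylor ranges of `P(y)` and `P(4y)`, `e^{−3y_0} ∈ [e^{−3(a+h)}, e^{−3a}]`, tail widened by
`tailC·|P|(9(a+h))·e^{−8a}`. -/
def cellIv (cs : List ℚ) (a h : ℚ) : Iv :=
  let A := prangeAt cs a h
  let B := prangeAt (scale4 cs) a h
  let E3 : Iv := ((expNegIv (3 * (a + h))).1, (expNegIv (3 * a)).2)
  let r := ceilG (tailC * pevalQ (absList cs) (9 * (a + h)) * (expNegIv (8 * a)).2)
  ivWiden (ivAdd A (ivMul B E3)) r

/-- **Soundness of the cell enclosure.** -/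
theorem mem_cellIv (cs : List ℚ) (hlen : cs.length ≤ 7) {a h : ℚ} (ha : 3 ≤ a) {x : ℝ} (hx : 0 < x)
    (h1 : (a : ℝ) ≤ thetaFreq x 0) (h2 : thetaFreq x 0 ≤ (a : ℝ) + h) :
    Mem (Real.exp (thetaFreq x 0) * ∑' n, qterm cs x n) (cellIv cs a h) := by
  have hy3 : 3 ≤ thetaFreq x 0 := le_trans (by exact_mod_cast ha) h1
  have hhR : (0 : ℝ) ≤ (h : ℝ) := by linarith
  have hh : (0 : ℚ) ≤ h := by exact_mod_cast hhR
  -- split off `n = 0, 1`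
  have hs := summable_qterm cs hx
  have hs1 : Summable fun n => qterm cs x (n + 1) := (summable_nat_add_iff 1).mpr hs
  have e1 : thetaFreq x 1 = 4 * thetaFreq x 0 := by rw [thetaFreq_eq_mul_zero x 1]; norm_num
  have ex1 : Real.exp (thetaFreq x 0) * Real.exp (-thetaFreq x 0) = 1 := by rw [← Real.exp_add]; simp
  have ex2 : Real.exp (thetaFreq x 0) * Real.exp (-(4 * thetaFreq x 0)) = Real.exp (-(3 * thetaFreq x 0)) := by
    rw [← Real.exp_add]; congr 1; ring
  have hsplit : Real.exp (thetaFreq x 0) * ∑' n, qterm cs x n =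
      (pevalR cs (thetaFreq x 0) + pevalR (scale4 cs) (thetaFreq x 0) * Real.exp (-(3 * thetaFreq x 0))) +
        Real.exp (thetaFreq x 0) * ∑' n, qterm cs x (n + 2) := by
    rw [hs.tsum_eq_zero_add, hs1.tsum_eq_zero_add]
    have et : (∑' n, qterm cs x (n + 1 + 1)) = ∑' n, qterm cs x (n + 2) := rfl
    rw [et, zero_add, pevalR_scale4]
    unfold qterm
    rw [e1]
    calc Real.exp (thetaFreq x 0) * (pevalR cs (thetaFreq x 0) * Real.exp (-thetaFreq x 0) +
          (pevalR cs (4 * thetaFreq x 0) * Real.exp (-(4 * thetaFreq x 0)) +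
          ∑' n, pevalR cs (thetaFreq x (n + 2)) * Real.exp (-thetaFreq x (n + 2))))
        = pevalR cs (thetaFreq x 0) * (Real.exp (thetaFreq x 0) * Real.exp (-thetaFreq x 0)) +
          pevalR cs (4 * thetaFreq x 0) * (Real.exp (thetaFreq x 0) * Real.exp (-(4 * thetaFreq x 0))) +
          Real.exp (thetaFreq x 0) * ∑' n, pevalR cs (thetaFreq x (n + 2)) * Real.exp (-thetaFreq x (n + 2)) := by
          ring
      _ = _ := by rw [ex1, ex2, mul_one]
  rw [hsplit]
  unfold cellIv
  apply mem_ivWiden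
  · apply mem_ivAdd (mem_prangeAt cs h1 h2)
    apply mem_ivMul (mem_prangeAt (scale4 cs) h1 h2)
    constructor
    · have hm := (mem_expNegIv (x := 3 * (a + h)) (by linarith)).1
      refine le_trans hm (Real.exp_le_exp.2 ?_); push_cast; linarith
    · have hm := (mem_expNegIv (x := 3 * a) (by linarith)).2
      refine le_trans (Real.exp_le_exp.2 ?_) hm; push_cast; linarith
  · -- the tail
    have ht := abs_tsum_qterm_tail_le cs hlen hx hy3
    apply real_le_ceilG
    rw [abs_mul, abs_of_pos (Real.exp_pos _)]
    have hexp8 : Real.exp (thetaFreq x 0) * Real.exp (-(9 * thetaFreq x 0)) = Real.exp (-(8 * thetaFreq x 0)) := by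
      rw [← Real.exp_add]; congr 1; ring
    have hm8 := (mem_expNegIv (x := 8 * a) (by linarith)).2
    have he8 : Real.exp (-(8 * thetaFreq x 0)) ≤ ((expNegIv (8 * a)).2 : ℝ) := by
      calc Real.exp (-(8 * thetaFreq x 0)) ≤ Real.exp (-((8 * a : ℚ) : ℝ)) :=
            Real.exp_le_exp.2 (by push_cast; linarith)
        _ ≤ _ := hm8
    have hP : pevalR (absList cs) (9 * thetaFreq x 0) ≤ ((pevalQ (absList cs) (9 * (a + h)) : ℚ) : ℝ) := by
      rw [← pevalR_ratCast]; push_cast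
      exact pevalR_absList_mono cs (by linarith) (by linarith)
    have hP0 : 0 ≤ pevalR (absList cs) (9 * thetaFreq x 0) := pevalR_absList_nonneg cs (by linarith)
    have htC : (0 : ℝ) ≤ tailC := by norm_num [tailC]
    calc Real.exp (thetaFreq x 0) * |∑' n, qterm cs x (n + 2)|
        ≤ Real.exp (thetaFreq x 0) * ((tailC : ℝ) * (pevalR (absList cs) (9 * thetaFreq x 0) *
            Real.exp (-(9 * thetaFreq x 0)))) := mul_le_mul_of_nonneg_left ht (Real.exp_pos _).le
      _ = (tailC : ℝ) * pevalR (absList cs) (9 * thetaFreq x 0) *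
            (Real.exp (thetaFreq x 0) * Real.exp (-(9 * thetaFreq x 0))) := by ring
      _ = (tailC : ℝ) * pevalR (absList cs) (9 * thetaFreq x 0) * Real.exp (-(8 * thetaFreq x 0)) := by rw [hexp8]
      _ ≤ (tailC : ℝ) * ((pevalQ (absList cs) (9 * (a + h)) : ℚ) : ℝ) * ((expNegIv (8 * a)).2 : ℝ) :=
          mul_le_mul (mul_le_mul_of_nonneg_left hP htC) he8 (Real.exp_pos _).le
            (mul_nonneg htC (hP0.trans hP))
      _ = _ := by push_cast; ring


end Summit.RiemannHypothesis.RiemannHypothesis.Theorems.JensenPolynomials.CoeffTable
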